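import Mathlib
import Summits.Ventures.PercRepro2.SwOutCrossJunctionThm
import Summits.Ventures.PercRepro2.SwOutCrossJunctionRealG
import Summits.Ventures.PercRepro2.SwOutCrossJunctionReadG

/-!
# THEOREM A_cross FOR ANY CROSS GRAPH WHOSE RECORD HAS THE INEQUALITY (blind cell PercRepro2,
night-4 g25, 2026-08-28; proofs/NIGHT4-G25.md §4)

The class partition of `SwOutCrossJunctionThm` (the key `keyX`, the blocks `blockOfX`) assembled
through `rigidOK_of_blocks` with the two connectivity-free ingredients: a core-kind point is in the
block of its base (`mem_blockX_baseX'`) and the block satisfies the rigid inequality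
(`card_blockX_le'`, from the abstract inequality `IneqAll G` of the record).
**`rigidOK_of_crossJunction'`**: the rigid inequality on every class of a junction whose dropped
vertices form ANY cross-edge graph `G` with `IneqAll G` — in particular (`SwOutCrossJunctionSwG`)
TWO connected components.
-/

namespace Summit.Ventures.PercRepro2

namespace CrossArm

open Hull LocRows

universe uV

variable {V : Type uV} {E : Type*} [Fintype E] [DecidableEq E]

open scoped Classical

variable {ends : E → Sym2 V} {X : Type*} [Fintype X] {U : Set V} {ξ : Config E} {l h o u : V}
  {p : X → V} {G : SimpleGraph X} [DecidableRel G.Adj]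

variable (hj : CrossJunction ends U h u p G o) (hl : l ∉ U) (hineq : IneqAll G V)
include hj hl

omit hineq in
/-- A `Q`-point that is not of the mixed kind is core-free (any cross graph). -/
lemma CrossJunction.coreFree_of_not_mixed' {ζ : Config E} (hζ : ζ ∈ swOutSide ends l h o U ξ)
    (hm : ¬ MixedKindX ends U ξ l h o u p G ζ) : CoreFree ends ζ h := by
  by_cases hu : u ∉ hull ends ζ h
  · exact coreFree_of_u_notMem_hull hj.hout hζ hu
  rw [not_not] at hu
  by_cases hk : hull ends ζ u ⊆ U
  · exfalso
    exact hm ⟨ζ, hζ, ⟨hu, hk⟩, hj.mem_blockX_baseX' hl hζ ⟨hu, hk⟩⟩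
  · exact coreFree_of_escaping hj.hout hζ hk

omit hineq in
/-- **Every `Q`-point lies in the block of its key** (any cross graph). -/
theorem CrossJunction.mem_blockOfX_keyX' {ζ : Config E} (hζ : ζ ∈ swOutSide ends l h o U ξ) :
    ζ ∈ blockOfX ends h u p G (keyX ends U ξ l h o u p G ζ) := by
  by_cases hm : MixedKindX ends U ξ l h o u p G ζ
  · rw [keyX_of_mixed hm]
    obtain ⟨ζ₀, hζ₀, hk₀, hmem⟩ := hm
    show ζ ∈ blockX ends h u p G (baseX ends h u p ζ)
    rw [hj.baseX_eq_of_mem_blockX hl hζ₀ hk₀ hmem]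
    exact hmem
  · rw [keyX_of_plain hm]
    have hc : CoreFree ends ζ h := hj.coreFree_of_not_mixed' hl hζ hm
    obtain ⟨ω, hω⟩ := exists_orbitReal_eq (ζ₀ := allRed ends ζ h) hc rfl
    show ζ ∈ orbit ends (allRed ends ζ h) h
    simp only [orbit, Finset.mem_image, Finset.mem_univ, true_and]
    exact ⟨ω, hω⟩

omit hineq in
/-- **Every `Q`-point of the block of a `Q`-point lies in the class with the same key** (any
cross graph). -/
theorem CrossJunction.keyX_eq_of_mem_blockOfX' {ζ : Config E} (hζ : ζ ∈ swOutSide ends l h o U ξ)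
    {ζ' : Config E} (hζ' : ζ' ∈ blockOfX ends h u p G (keyX ends U ξ l h o u p G ζ))
    (hQ : ζ' ∈ tgtU ends l h {S : Set V | o ∈ S}) :
    ζ' ∈ swOutSide ends l h o U ξ ∧ keyX ends U ξ l h o u p G ζ' = keyX ends U ξ l h o u p G ζ := by
  by_cases hm : MixedKindX ends U ξ l h o u p G ζ
  · rw [keyX_of_mixed hm] at hζ' ⊢
    obtain ⟨ζ₀, hζ₀, hk₀, hmem⟩ := hm
    have hb' : ζ' ∈ blockX ends h u p G (baseX ends h u p ζ₀) := by
      have := hζ'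
      rwa [show blockOfX ends h u p G (Sum.inr (baseX ends h u p ζ)) = blockX ends h u p G (baseX ends h u p ζ)
        from rfl, hj.baseX_eq_of_mem_blockX hl hζ₀ hk₀ hmem] at this
    have hm' : MixedKindX ends U ξ l h o u p G ζ' := ⟨ζ₀, hζ₀, hk₀, hb'⟩
    refine ⟨mem_swOutSide.2 ⟨hQ, hj.mem_outClass_of_mem_blockX hl hζ₀ hk₀ hb'⟩, ?_⟩
    rw [keyX_of_mixed hm', hj.baseX_eq_of_mem_blockX hl hζ₀ hk₀ hb',
      hj.baseX_eq_of_mem_blockX hl hζ₀ hk₀ hmem]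
  · rw [keyX_of_plain hm] at hζ' ⊢
    have hc : CoreFree ends ζ h := hj.coreFree_of_not_mixed' hl hζ hm
    have hc₀ : CoreFree ends (allRed ends ζ h) h := coreFree_allRed hc
    have hcl₀ : allRed ends ζ h ∈ outClass ends U h ξ :=
      allRed_mem_outClass (mem_swOutSide.1 hζ).2 hc
    have hmem := hζ'
    simp only [blockOfX, orbit, Finset.mem_image, Finset.mem_univ, true_and] at hmem
    obtain ⟨ω', rfl⟩ := hmem
    have hζ'cl : orbitReal ends (allRed ends ζ h) h ω' ∈ swOutSide ends l h o U ξ :=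
      mem_swOutSide.2 ⟨hQ, orbitReal_mem_outClass hc₀ hcl₀ ω'⟩
    have hc' : CoreFree ends (orbitReal ends (allRed ends ζ h) h ω') h := coreFree_orbitReal hc₀ ω'
    have hall : allRed ends (orbitReal ends (allRed ends ζ h) h ω') h = allRed ends ζ h := by
      rw [allRed_orbitReal hc₀, allRed_idem hc]
    have hζorb : ζ ∈ orbit ends (allRed ends (orbitReal ends (allRed ends ζ h) h ω') h) h := by
      rw [hall]
      obtain ⟨ω, hω⟩ := exists_orbitReal_eq (ζ₀ := allRed ends ζ h) hc rfl
      simp only [orbit, Finset.mem_image, Finset.mem_univ, true_and]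
      exact ⟨ω, hω⟩
    -- a point of the mixed kind in the orbit would put `ζ` into its block
    have hm' : ¬ MixedKindX ends U ξ l h o u p G (orbitReal ends (allRed ends ζ h) h ω') := by
      rintro ⟨ζ₀, hζ₀, hk₀, hmem⟩
      exact hm ⟨ζ₀, hζ₀, hk₀, hj.mem_blockX_of_mem_orbit hl hζ₀ hk₀ hmem hc' hζorb⟩
    exact ⟨hζ'cl, by rw [keyX_of_plain hm', hall]⟩

include hineq

/-- **Every block of a `Q`-point satisfies the rigid inequality** (any cross graph with the
inequality). -/
theorem CrossJunction.card_blockOfX_le' {ζ : Config E} (hζ : ζ ∈ swOutSide ends l h o U ξ)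
    {𝓔 : Set (Set E)} (h𝓔 : IsUpperSet 𝓔) :
    ((blockOfX ends h u p G (keyX ends U ξ l h o u p G ζ)).filter fun ζ' =>
        ζ' ∈ tgtU ends l h {S : Set V | o ∈ S} ∧ redEdges ends ζ' h ∈ 𝓔).card ≤
      ((blockOfX ends h u p G (keyX ends U ξ l h o u p G ζ)).filter fun ζ' =>
        ζ' ∈ tgtU ends l h {S : Set V | o ∈ S} ∧ blueEdges ends ζ' h ∈ 𝓔).card := by
  by_cases hm : MixedKindX ends U ξ l h o u p G ζ
  · rw [keyX_of_mixed hm]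
    obtain ⟨ζ₀, hζ₀, hk₀, hmem⟩ := hm
    show ((blockX ends h u p G (baseX ends h u p ζ)).filter _).card ≤
      ((blockX ends h u p G (baseX ends h u p ζ)).filter _).card
    rw [hj.baseX_eq_of_mem_blockX hl hζ₀ hk₀ hmem]
    exact hj.card_blockX_le' hl hζ₀ hk₀ hineq h𝓔
  · rw [keyX_of_plain hm]
    have hc : CoreFree ends ζ h := hj.coreFree_of_not_mixed' hl hζ hm
    have hc₀ : CoreFree ends (allRed ends ζ h) h := coreFree_allRed hc
    have hcl₀ : allRed ends ζ h ∈ outClass ends U h ξ :=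
      allRed_mem_outClass (mem_swOutSide.1 hζ).2 hc
    exact card_orbit_le hc₀ hj.hloop_h hcl₀ hl h𝓔

/-- **THEOREM A_cross FOR ANY CROSS GRAPH WITH THE INEQUALITY: the rigid inequality on every
cross-junction class**, for every outside colouring. -/
theorem CrossJunction.rigidOK_of_crossJunction' : RigidOK ends l h o U ξ :=
  rigidOK_of_blocks ξ (keyX ends U ξ l h o u p G) (blockOfX ends h u p G)
    (fun _ hζ => hj.mem_blockOfX_keyX' hl hζ)
    (fun _ hζ _ hζ' hQ => hj.keyX_eq_of_mem_blockOfX' hl hζ hζ' hQ)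
    (fun _ hζ _ h𝓔 => hj.card_blockOfX_le' hl hineq hζ h𝓔)

end CrossArm

end Summit.Ventures.PercRepro2
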